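import Summits.BirchSwinnertonDyer.BirchSwinnertonDyer.Theorems.ManinLocalTwoThreeEulerRemaindersFiftySix
import HarnessLib

/-!
# The level-`56` `η`-quotients `U`, `V`, `P`, `Q` (and `φ₁₄`) as `q`-monomials times Euler functions; the derivative of `U`

Cell bsd-f2-manin, route `ManinLocalTwoThree` (crux C2 `ManinOddAtFour`, stmt-22967: `2² ∣ 56`), prover seat p2 gen 28; sequel to
`EulerRemaindersFiftySix`.  With `E_δ = eulerFn δ`, `q = e^{2πiτ}`:

* §0 `E₁ = 1 − q − q² + q⁵ + q⁷ − q¹² − q¹⁵ + o(q¹⁵)`, `E₇ = 1 − q⁷ − q¹⁴ + o(q¹⁵)` (pentagonal coefficients of `EulerRemaindersFiftySix`);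
* §1 `U = η₄³η₂₈³/(η₂η₈²η₁₄η₅₆²) = E₄³E₂₈³/(q²E₂E₈²E₁₄E₅₆²)` — the function `x + 1` on `56a1 = [0,0,0,1,2]` pulled back to `X₀(56)`
  (a single `η`-quotient, poles at the two cusps `∞`, `1/8` of the fibre over `O`, double zeros at the cusps `1/4`, `1/28`), and
  `x(56b1) = U + 4/U − 2` for `56b1 = [0,−1,0,0,−4]`;
  `V = η₂²η₄η₁₄²η₂₈/(η₁η₇η₈²η₅₆²) = E₂²E₄E₁₄²E₂₈/(q³E₁E₇E₈²E₅₆²)` — the function `y + x + 1` on `56a1`;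
  `P = η₄³η₁₄³/(η₂η₂₈) = qE₄³E₁₄³/(E₂E₂₈)`, `Q = η₂³η₂₈³/(η₄η₁₄) = q³E₂³E₂₈³/(E₄E₁₄)` — the two newforms of level `56` are
  `56a = P − Q`, `56b = P + Q` (planner-an g51 turnkey T-an-g51-56); `φ₁₄ = η₁η₂η₇η₁₄ = qE₁E₂E₇E₁₄` (tree `cuspFormEta14`).
* §2 the logarithmic derivative `deriv_U56`.

(Seat-folder certificate `scripts/level56.py`: all identities of the level-`56` programme hold to `O(q⁸⁴)` in exact arithmetic.)
No definition, no named fact, no sorry; nothing here proves C2, Manin's conjecture or BSD. [cite: CremonaAlgorithms1997, Table 3 (N = 56)]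
-/

set_option autoImplicit false
-- lint-debt: the directory name repeats the summit name (sibling precedent `ManinLocalTwoThreeEulerRemaindersForty.lean`)
set_option linter.dupNamespace false

noncomputable section

open Complex Filter Topology Set Asymptotics Polynomial
open UpperHalfPlane hiding I
open scoped Real Topology Manifold MatrixGroups
open Literature.NumberTheory.EllipticCurves Literature.NumberTheory.EllipticCurves.ModularForms

namespace Summit.BirchSwinnertonDyer.BirchSwinnertonDyer.Theorems.ManinLocalTwoThree.EtaMonomialsFiftySix

open QRemainder EulerRemainders
open LigozatIdentities (hasDerivAt_eulerFn_comp)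
open EulerRemaindersSixtyFour (cexp_eq_qParam_pow)

/-! ## §0 `E₁`, `E₇` modulo `o(q¹⁵)` -/

/-- The `q`-coefficients `0, …, 15` of `E₁` (`1 - q - q ^ 2 + q ^ 5 + q ^ 7 - q ^ 12 - q ^ 15`). [folklore] -/
theorem coeff_formalEulerScaled_one_le_fifteen (n : ℕ) (hn : n ≤ 15) :
    PowerSeries.coeff n (formalEulerScaled 1) = if n = 0 then 1 else if n = 1 then -1 else if n = 2 then -1 else if n = 5 then 1 else if n = 7 then 1 else if n = 12 then -1 else if n = 15 then -1 else 0 := by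
  have h0 := EulerRemaindersFiftySix.coeff_formalEulerPow_one_le_sixteen 0 (by norm_num) 
  have h1 := EulerRemaindersFiftySix.coeff_formalEulerPow_one_le_sixteen 1 (by norm_num) 
  have h2 := EulerRemaindersFiftySix.coeff_formalEulerPow_one_le_sixteen 2 (by norm_num) 
  have h3 := EulerRemaindersFiftySix.coeff_formalEulerPow_one_le_sixteen 3 (by norm_num) 
  have h4 := EulerRemaindersFiftySix.coeff_formalEulerPow_one_le_sixteen 4 (by norm_num) 
  have h5 := EulerRemaindersFiftySix.coeff_formalEulerPow_one_le_sixteen 5 (by norm_num) 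
  have h6 := EulerRemaindersFiftySix.coeff_formalEulerPow_one_le_sixteen 6 (by norm_num) 
  have h7 := EulerRemaindersFiftySix.coeff_formalEulerPow_one_le_sixteen 7 (by norm_num) 
  have h8 := EulerRemaindersFiftySix.coeff_formalEulerPow_one_le_sixteen 8 (by norm_num) 
  have h9 := EulerRemaindersFiftySix.coeff_formalEulerPow_one_le_sixteen 9 (by norm_num) 
  have h10 := EulerRemaindersFiftySix.coeff_formalEulerPow_one_le_sixteen 10 (by norm_num) 
  have h11 := EulerRemaindersFiftySix.coeff_formalEulerPow_one_le_sixteen 11 (by norm_num) 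
  have h12 := EulerRemaindersFiftySix.coeff_formalEulerPow_one_le_sixteen 12 (by norm_num) 
  have h13 := EulerRemaindersFiftySix.coeff_formalEulerPow_one_le_sixteen 13 (by norm_num) 
  have h14 := EulerRemaindersFiftySix.coeff_formalEulerPow_one_le_sixteen 14 (by norm_num) 
  have h15 := EulerRemaindersFiftySix.coeff_formalEulerPow_one_le_sixteen 15 (by norm_num)
  simp only at h0 h1 h2 h3 h4 h5 h6 h7 h8 h9 h10 h11 h12 h13 h14 h15
  interval_cases n <;> simp +decide [coeff_formalEulerScaled, h0, h1, h2, h3, h4, h5, h6, h7, h8, h9, h10, h11, h12, h13, h14, h15]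

/-- **`E₁ = 1 - q - q ^ 2 + q ^ 5 + q ^ 7 - q ^ 12 - q ^ 15 + o(q¹⁵)`.** [folklore] -/
theorem tendsto_eulerFn_one_fifteen :
    Tendsto (fun τ : ℍ ↦ (eulerFn 1 τ - (1 - X - X ^ 2 + X ^ 5 + X ^ 7 - X ^ 12 - X ^ 15 : ℂ[X]).eval (Function.Periodic.qParam 1 (τ : ℂ)))
      / Function.Periodic.qParam 1 (τ : ℂ) ^ 15) atImInfty (𝓝 0) := by
  refine congr_poly ?_ (tendsto_of_hasSum (periodic_eulerFn 1) (mdifferentiable_eulerFn 1)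
    (isBoundedAtImInfty_eulerFn (by norm_num)) (hasSum_eulerFn (by norm_num)) 15)
  have h := coeff_formalEulerScaled_one_le_fifteen
  simp only [Finset.sum_range_succ, Finset.sum_range_zero, h 0 (by norm_num), h 1 (by norm_num), h 2 (by norm_num), h 3 (by norm_num), h 4 (by norm_num), h 5 (by norm_num), h 6 (by norm_num), h 7 (by norm_num), h 8 (by norm_num), h 9 (by norm_num), h 10 (by norm_num), h 11 (by norm_num), h 12 (by norm_num), h 13 (by norm_num), h 14 (by norm_num), h 15 (by norm_num)]
  norm_num
  ring

/-- The `q`-coefficients `0, …, 15` of `E₇` (`1 - q ^ 7 - q ^ 14`). [folklore] -/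
theorem coeff_formalEulerScaled_seven_le_fifteen (n : ℕ) (hn : n ≤ 15) :
    PowerSeries.coeff n (formalEulerScaled 7) = if n = 0 then 1 else if n = 7 then -1 else if n = 14 then -1 else 0 := by
  have h0 := EulerRemaindersFiftySix.coeff_formalEulerPow_one_le_sixteen 0 (by norm_num) 
  have h1 := EulerRemaindersFiftySix.coeff_formalEulerPow_one_le_sixteen 1 (by norm_num) 
  have h2 := EulerRemaindersFiftySix.coeff_formalEulerPow_one_le_sixteen 2 (by norm_num)
  simp only at h0 h1 h2
  interval_cases n <;> simp +decide [coeff_formalEulerScaled, h0, h1, h2]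

/-- **`E₇ = 1 - q ^ 7 - q ^ 14 + o(q¹⁵)`.** [folklore] -/
theorem tendsto_eulerFn_seven_fifteen :
    Tendsto (fun τ : ℍ ↦ (eulerFn 7 τ - (1 - X ^ 7 - X ^ 14 : ℂ[X]).eval (Function.Periodic.qParam 1 (τ : ℂ)))
      / Function.Periodic.qParam 1 (τ : ℂ) ^ 15) atImInfty (𝓝 0) := by
  refine congr_poly ?_ (tendsto_of_hasSum (periodic_eulerFn 7) (mdifferentiable_eulerFn 7)
    (isBoundedAtImInfty_eulerFn (by norm_num)) (hasSum_eulerFn (by norm_num)) 15)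
  have h := coeff_formalEulerScaled_seven_le_fifteen
  simp only [Finset.sum_range_succ, Finset.sum_range_zero, h 0 (by norm_num), h 1 (by norm_num), h 2 (by norm_num), h 3 (by norm_num), h 4 (by norm_num), h 5 (by norm_num), h 6 (by norm_num), h 7 (by norm_num), h 8 (by norm_num), h 9 (by norm_num), h 10 (by norm_num), h 11 (by norm_num), h 12 (by norm_num), h 13 (by norm_num), h 14 (by norm_num), h 15 (by norm_num)]
  norm_num
  ring

/-! ## §1 `U`, `V`, `P`, `Q`, `φ₁₄` in terms of `q` and the Euler functions -/

/-- **`U = η₄³η₂₈³/(η₂η₈²η₁₄η₅₆²) = E₄³E₂₈³/(q² E₂E₈²E₁₄E₅₆²)` (`= x + 1` on `56a1`).** [folklore] -/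
theorem U56_eq (τ : ℍ) :
    etaQuotient 56 (expFn [(2, -1), (4, 3), (8, -2), (14, -1), (28, 3), (56, -2)]) τ
      = eulerFn 4 τ ^ 3 * eulerFn 28 τ ^ 3 / (Function.Periodic.qParam 1 (τ : ℂ) ^ 2 * eulerFn 2 τ * eulerFn 8 τ ^ 2 * eulerFn 14 τ * eulerFn 56 τ ^ 2) := by
  have hE2 := eulerFn_ne_zero (by norm_num : 0 < 2) τ
  have hE8 := eulerFn_ne_zero (by norm_num : 0 < 8) τ
  have hE14 := eulerFn_ne_zero (by norm_num : 0 < 14) τ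
  have hE56 := eulerFn_ne_zero (by norm_num : 0 < 56) τ
  have hq := qParam_ne_zero τ
  rw [etaQuotient_eq_cexp_mul_prod, show Nat.divisors 56 = {1, 2, 4, 7, 8, 14, 28, 56} by decide]
  have hsum : (∑ δ ∈ ({1, 2, 4, 7, 8, 14, 28, 56} : Finset ℕ),
      (δ : ℤ) * expFn [(2, -1), (4, 3), (8, -2), (14, -1), (28, 3), (56, -2)] δ) = (-(24 * 2 : ℕ) : ℤ) := by decide
  rw [hsum, cexp_neg_eq_inv_qParam_pow]
  rw [Finset.prod_insert (by decide), Finset.prod_insert (by decide), Finset.prod_insert (by decide), Finset.prod_insert (by decide), Finset.prod_insert (by decide), Finset.prod_insert (by decide), Finset.prod_insert (by decide),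
    Finset.prod_singleton]
  rw [show expFn [(2, -1), (4, 3), (8, -2), (14, -1), (28, 3), (56, -2)] 1 = 0 by decide,
    show expFn [(2, -1), (4, 3), (8, -2), (14, -1), (28, 3), (56, -2)] 2 = (-1) by decide,
    show expFn [(2, -1), (4, 3), (8, -2), (14, -1), (28, 3), (56, -2)] 4 = 3 by decide,
    show expFn [(2, -1), (4, 3), (8, -2), (14, -1), (28, 3), (56, -2)] 7 = 0 by decide,
    show expFn [(2, -1), (4, 3), (8, -2), (14, -1), (28, 3), (56, -2)] 8 = (-2) by decide,
    show expFn [(2, -1), (4, 3), (8, -2), (14, -1), (28, 3), (56, -2)] 14 = (-1) by decide,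
    show expFn [(2, -1), (4, 3), (8, -2), (14, -1), (28, 3), (56, -2)] 28 = 3 by decide,
    show expFn [(2, -1), (4, 3), (8, -2), (14, -1), (28, 3), (56, -2)] 56 = (-2) by decide]
  simp only [zpow_neg, zpow_ofNat]
  field_simp

/-- **`V = η₂²η₄η₁₄²η₂₈/(η₁η₇η₈²η₅₆²) = E₂²E₄E₁₄²E₂₈/(q³ E₁E₇E₈²E₅₆²)` (`= y + x + 1` on `56a1`).** [folklore] -/
theorem V56_eq (τ : ℍ) :
    etaQuotient 56 (expFn [(1, -1), (2, 2), (4, 1), (7, -1), (8, -2), (14, 2), (28, 1), (56, -2)]) τ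
      = eulerFn 2 τ ^ 2 * eulerFn 4 τ * eulerFn 14 τ ^ 2 * eulerFn 28 τ / (Function.Periodic.qParam 1 (τ : ℂ) ^ 3 * eulerFn 1 τ * eulerFn 7 τ * eulerFn 8 τ ^ 2 * eulerFn 56 τ ^ 2) := by
  have hE1 := eulerFn_ne_zero (by norm_num : 0 < 1) τ
  have hE7 := eulerFn_ne_zero (by norm_num : 0 < 7) τ
  have hE8 := eulerFn_ne_zero (by norm_num : 0 < 8) τ
  have hE56 := eulerFn_ne_zero (by norm_num : 0 < 56) τ
  have hq := qParam_ne_zero τ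
  rw [etaQuotient_eq_cexp_mul_prod, show Nat.divisors 56 = {1, 2, 4, 7, 8, 14, 28, 56} by decide]
  have hsum : (∑ δ ∈ ({1, 2, 4, 7, 8, 14, 28, 56} : Finset ℕ),
      (δ : ℤ) * expFn [(1, -1), (2, 2), (4, 1), (7, -1), (8, -2), (14, 2), (28, 1), (56, -2)] δ) = (-(24 * 3 : ℕ) : ℤ) := by decide
  rw [hsum, cexp_neg_eq_inv_qParam_pow]
  rw [Finset.prod_insert (by decide), Finset.prod_insert (by decide), Finset.prod_insert (by decide), Finset.prod_insert (by decide), Finset.prod_insert (by decide), Finset.prod_insert (by decide), Finset.prod_insert (by decide),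
    Finset.prod_singleton]
  rw [show expFn [(1, -1), (2, 2), (4, 1), (7, -1), (8, -2), (14, 2), (28, 1), (56, -2)] 1 = (-1) by decide,
    show expFn [(1, -1), (2, 2), (4, 1), (7, -1), (8, -2), (14, 2), (28, 1), (56, -2)] 2 = 2 by decide,
    show expFn [(1, -1), (2, 2), (4, 1), (7, -1), (8, -2), (14, 2), (28, 1), (56, -2)] 4 = 1 by decide,
    show expFn [(1, -1), (2, 2), (4, 1), (7, -1), (8, -2), (14, 2), (28, 1), (56, -2)] 7 = (-1) by decide,
    show expFn [(1, -1), (2, 2), (4, 1), (7, -1), (8, -2), (14, 2), (28, 1), (56, -2)] 8 = (-2) by decide,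
    show expFn [(1, -1), (2, 2), (4, 1), (7, -1), (8, -2), (14, 2), (28, 1), (56, -2)] 14 = 2 by decide,
    show expFn [(1, -1), (2, 2), (4, 1), (7, -1), (8, -2), (14, 2), (28, 1), (56, -2)] 28 = 1 by decide,
    show expFn [(1, -1), (2, 2), (4, 1), (7, -1), (8, -2), (14, 2), (28, 1), (56, -2)] 56 = (-2) by decide]
  simp only [zpow_neg, zpow_ofNat]
  field_simp

/-- **`P = η₄³η₁₄³/(η₂η₂₈) = q E₄³E₁₄³/(E₂E₂₈)`.** [folklore] -/
theorem P56_eq (τ : ℍ) :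
    etaQuotient 56 (expFn [(2, -1), (4, 3), (14, 3), (28, -1)]) τ
      = Function.Periodic.qParam 1 (τ : ℂ) * eulerFn 4 τ ^ 3 * eulerFn 14 τ ^ 3
        / (eulerFn 2 τ * eulerFn 28 τ) := by
  have hE2 := eulerFn_ne_zero (by norm_num : 0 < 2) τ
  have hE28 := eulerFn_ne_zero (by norm_num : 0 < 28) τ
  have hq := qParam_ne_zero τ
  rw [etaQuotient_eq_cexp_mul_prod, show Nat.divisors 56 = {1, 2, 4, 7, 8, 14, 28, 56} by decide]
  have hsum : (∑ δ ∈ ({1, 2, 4, 7, 8, 14, 28, 56} : Finset ℕ),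
      (δ : ℤ) * expFn [(2, -1), (4, 3), (14, 3), (28, -1)] δ) = ((24 * 1 : ℕ) : ℤ) := by decide
  rw [hsum, cexp_eq_qParam_pow, pow_one]
  rw [Finset.prod_insert (by decide), Finset.prod_insert (by decide), Finset.prod_insert (by decide), Finset.prod_insert (by decide), Finset.prod_insert (by decide), Finset.prod_insert (by decide), Finset.prod_insert (by decide),
    Finset.prod_singleton]
  rw [show expFn [(2, -1), (4, 3), (14, 3), (28, -1)] 1 = 0 by decide,
    show expFn [(2, -1), (4, 3), (14, 3), (28, -1)] 2 = (-1) by decide,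
    show expFn [(2, -1), (4, 3), (14, 3), (28, -1)] 4 = 3 by decide,
    show expFn [(2, -1), (4, 3), (14, 3), (28, -1)] 7 = 0 by decide,
    show expFn [(2, -1), (4, 3), (14, 3), (28, -1)] 8 = 0 by decide,
    show expFn [(2, -1), (4, 3), (14, 3), (28, -1)] 14 = 3 by decide,
    show expFn [(2, -1), (4, 3), (14, 3), (28, -1)] 28 = (-1) by decide,
    show expFn [(2, -1), (4, 3), (14, 3), (28, -1)] 56 = 0 by decide]
  simp only [zpow_neg, zpow_ofNat]
  field_simp

/-- **`Q = η₂³η₂₈³/(η₄η₁₄) = q³ E₂³E₂₈³/(E₄E₁₄)`.** [folklore] -/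
theorem Q56_eq (τ : ℍ) :
    etaQuotient 56 (expFn [(2, 3), (4, -1), (14, -1), (28, 3)]) τ
      = Function.Periodic.qParam 1 (τ : ℂ) ^ 3 * eulerFn 2 τ ^ 3 * eulerFn 28 τ ^ 3
        / (eulerFn 4 τ * eulerFn 14 τ) := by
  have hE4 := eulerFn_ne_zero (by norm_num : 0 < 4) τ
  have hE14 := eulerFn_ne_zero (by norm_num : 0 < 14) τ
  have hq := qParam_ne_zero τ
  rw [etaQuotient_eq_cexp_mul_prod, show Nat.divisors 56 = {1, 2, 4, 7, 8, 14, 28, 56} by decide]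
  have hsum : (∑ δ ∈ ({1, 2, 4, 7, 8, 14, 28, 56} : Finset ℕ),
      (δ : ℤ) * expFn [(2, 3), (4, -1), (14, -1), (28, 3)] δ) = ((24 * 3 : ℕ) : ℤ) := by decide
  rw [hsum, cexp_eq_qParam_pow]
  rw [Finset.prod_insert (by decide), Finset.prod_insert (by decide), Finset.prod_insert (by decide), Finset.prod_insert (by decide), Finset.prod_insert (by decide), Finset.prod_insert (by decide), Finset.prod_insert (by decide),
    Finset.prod_singleton]
  rw [show expFn [(2, 3), (4, -1), (14, -1), (28, 3)] 1 = 0 by decide,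
    show expFn [(2, 3), (4, -1), (14, -1), (28, 3)] 2 = 3 by decide,
    show expFn [(2, 3), (4, -1), (14, -1), (28, 3)] 4 = (-1) by decide,
    show expFn [(2, 3), (4, -1), (14, -1), (28, 3)] 7 = 0 by decide,
    show expFn [(2, 3), (4, -1), (14, -1), (28, 3)] 8 = 0 by decide,
    show expFn [(2, 3), (4, -1), (14, -1), (28, 3)] 14 = (-1) by decide,
    show expFn [(2, 3), (4, -1), (14, -1), (28, 3)] 28 = 3 by decide,
    show expFn [(2, 3), (4, -1), (14, -1), (28, 3)] 56 = 0 by decide]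
  simp only [zpow_neg, zpow_ofNat]
  field_simp

/-- **`φ₁₄ = η₁η₂η₇η₁₄ = q E₁E₂E₇E₁₄` (the newform of level `14`).** [folklore] -/
theorem phi14_eq (τ : ℍ) :
    etaQuotient 14 (expFn [(1, 1), (2, 1), (7, 1), (14, 1)]) τ
      = Function.Periodic.qParam 1 (τ : ℂ) * eulerFn 1 τ * eulerFn 2 τ * eulerFn 7 τ * eulerFn 14 τ := by

  have hq := qParam_ne_zero τ
  rw [etaQuotient_eq_cexp_mul_prod, show Nat.divisors 14 = {1, 2, 7, 14} by decide]
  have hsum : (∑ δ ∈ ({1, 2, 7, 14} : Finset ℕ),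
      (δ : ℤ) * expFn [(1, 1), (2, 1), (7, 1), (14, 1)] δ) = ((24 * 1 : ℕ) : ℤ) := by decide
  rw [hsum, cexp_eq_qParam_pow, pow_one]
  rw [Finset.prod_insert (by decide), Finset.prod_insert (by decide), Finset.prod_insert (by decide),
    Finset.prod_singleton]
  rw [show expFn [(1, 1), (2, 1), (7, 1), (14, 1)] 1 = 1 by decide,
    show expFn [(1, 1), (2, 1), (7, 1), (14, 1)] 2 = 1 by decide,
    show expFn [(1, 1), (2, 1), (7, 1), (14, 1)] 7 = 1 by decide,
    show expFn [(1, 1), (2, 1), (7, 1), (14, 1)] 14 = 1 by decide]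
  simp only [zpow_ofNat]
  field_simp

/-! ## §2 The derivative of `U` -/

/-- **`U′ = U · (3E₄′/E₄ + 3E₂₈′/E₂₈ − 2·2πi − E₂′/E₂ − 2E₈′/E₈ − E₁₄′/E₁₄ − 2E₅₆′/E₅₆)`.** [folklore] -/
theorem deriv_U56 (τ : ℍ) :
    deriv (etaQuotient 56 (expFn [(2, -1), (4, 3), (8, -2), (14, -1), (28, 3), (56, -2)]) ∘ ofComplex) τ
      = eulerFn 4 τ ^ 3 * eulerFn 28 τ ^ 3
          / (Function.Periodic.qParam 1 (τ : ℂ) ^ 2 * eulerFn 2 τ * eulerFn 8 τ ^ 2 * eulerFn 14 τ * eulerFn 56 τ ^ 2)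
        * (3 * deriv (eulerFn 4 ∘ ofComplex) τ / eulerFn 4 τ
          + 3 * deriv (eulerFn 28 ∘ ofComplex) τ / eulerFn 28 τ - 2 * (2 * π * I)
          - deriv (eulerFn 2 ∘ ofComplex) τ / eulerFn 2 τ
          - 2 * deriv (eulerFn 8 ∘ ofComplex) τ / eulerFn 8 τ
          - deriv (eulerFn 14 ∘ ofComplex) τ / eulerFn 14 τ
          - 2 * deriv (eulerFn 56 ∘ ofComplex) τ / eulerFn 56 τ) := by
  have hE2 := eulerFn_ne_zero (by norm_num : 0 < 2) τ
  have hE4 := eulerFn_ne_zero (by norm_num : 0 < 4) τ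
  have hE8 := eulerFn_ne_zero (by norm_num : 0 < 8) τ
  have hE14 := eulerFn_ne_zero (by norm_num : 0 < 14) τ
  have hE28 := eulerFn_ne_zero (by norm_num : 0 < 28) τ
  have hE56 := eulerFn_ne_zero (by norm_num : 0 < 56) τ
  have hq := qParam_ne_zero τ
  have hfun : (etaQuotient 56 (expFn [(2, -1), (4, 3), (8, -2), (14, -1), (28, 3), (56, -2)]) ∘ ofComplex) =ᶠ[𝓝 (τ : ℂ)]
      fun z ↦ (eulerFn 4 ∘ ofComplex) z ^ 3 * (eulerFn 28 ∘ ofComplex) z ^ 3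
        / (Function.Periodic.qParam 1 z ^ 2 * (eulerFn 2 ∘ ofComplex) z * (eulerFn 8 ∘ ofComplex) z ^ 2
          * (eulerFn 14 ∘ ofComplex) z * (eulerFn 56 ∘ ofComplex) z ^ 2) := by
    filter_upwards [isOpen_upperHalfPlaneSet.mem_nhds τ.im_pos] with z hz
    simp only [Function.comp_apply, U56_eq, ofComplex_apply_of_im_pos hz]
  rw [hfun.deriv_eq]
  have h2 := hasDerivAt_eulerFn_comp 2 τ
  have h4 := hasDerivAt_eulerFn_comp 4 τ
  have h8 := hasDerivAt_eulerFn_comp 8 τ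
  have h14 := hasDerivAt_eulerFn_comp 14 τ
  have h28 := hasDerivAt_eulerFn_comp 28 τ
  have h56 := hasDerivAt_eulerFn_comp 56 τ
  have hqd : HasDerivAt (Function.Periodic.qParam 1) (2 * π * I * Function.Periodic.qParam 1 (τ : ℂ)) τ := by
    simpa using hasDerivAt_qParam 1 (τ : ℂ)
  have hden : Function.Periodic.qParam 1 (τ : ℂ) ^ 2 * (eulerFn 2 ∘ ofComplex) τ * (eulerFn 8 ∘ ofComplex) τ ^ 2
      * (eulerFn 14 ∘ ofComplex) τ * (eulerFn 56 ∘ ofComplex) τ ^ 2 ≠ 0 := by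
    simp only [Function.comp_apply, ofComplex_apply]
    exact mul_ne_zero (mul_ne_zero (mul_ne_zero (mul_ne_zero (pow_ne_zero _ hq) hE2) (pow_ne_zero _ hE8)) hE14)
      (pow_ne_zero _ hE56)
  have hD := ((h4.fun_pow 3).fun_mul (h28.fun_pow 3)).fun_div
    (((((hqd.fun_pow 2).fun_mul h2).fun_mul (h8.fun_pow 2)).fun_mul h14).fun_mul (h56.fun_pow 2)) hden
  rw [hD.deriv]
  simp only [Function.comp_apply, ofComplex_apply]
  field_simp
  ring

end Summit.BirchSwinnertonDyer.BirchSwinnertonDyer.Theorems.ManinLocalTwoThree.EtaMonomialsFiftySix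

end
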